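import Mathlib
import Literature.NumberTheory.NumberFields.LenstraDifferentBound
import HarnessLib

/-!
# The codifferent of a real-rooted normalisation is a sum of two squares times a square
# (Hanselka 2017, §4: squares in the narrow class group, Cor. 4.2 modulo Thm. 4.1)

Topic `Literature/AlgebraicGeometry/DeterminantalHypersurfaces`. C. Hanselka, *Characteristic
polynomials of symmetric matrices over the univariate polynomial ring*, J. Algebra 487 (2017)
340–356 (arXiv:1610.06634), **Corollary 4.2**: "Let `A` be a Dedekind domain that is a finitely
generated `ℝ`-algebra and `J ∈ 𝓘_A` a fractional `A`-ideal. Then the class of `J` is a square in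
the narrow class group `Cl₊ A` if and only if all real prime ideals appear in `J` with even
order. In other words there exists `I ∈ 𝓘_A` and a sum of squares `c ∈ Quot A` such that
`J = cI²` if and only if `2 | v_𝔭(J)` for every nonzero real `𝔭 ∈ Spec A`", whose proof rests on
**Theorem 4.1** ("If `A` is a Dedekind domain that is a finitely generated `ℂ`-algebra, then
its class group is divisible" — Jacobians / Frey 1979), and its use in **§5** (proof of Thm. 1):
"Using Corollary 4.2 it now follows that the class of `Δ` in the narrow class group `Cl₊ B` is a
square, i.e., there exists a sum of squares `c ∈ L×` and a fractional ideal `I ∈ 𝓘_B` such that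
`cI² = Δ`."

We prove the "if" direction in exactly the situation of §5 and **modulo Theorem 4.1, which is
taken as an explicit hypothesis** `hdiv` (2-divisibility of the class group of
`B' = B ⊗_ℝ ℂ = B[j]`, the integral closure of `B` in `L' = L(j)`, `j² = −1`); Theorem 4.1 itself
(divisibility of the Jacobian of a complex curve) is not in Mathlib and is NOT asserted here:

* `exists_inv_differentIdeal_eq_spanSingleton_mul_sq` / `exists_dual_eq_spanSingleton_mul_sq`
  — let `B` be the integral closure of `ℝ[x]` in a finite extension `L` of `K = ℝ(x)` such that
  `−1` is not a square in `L` and every prime of `B` dividing the different `𝔇_{B|ℝ[x]}` is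
  non-real (`−1` is a square modulo it — for real-rooted families this is
  `exists_mul_self_eq_neg_one_of_dvd_differentIdeal` of `RealFibresUnramified.lean`,
  Hanselka's Cor. 3.5); let `L' ⊇ L` be quadratic containing `j` with `j² = −1` and `B'` the
  integral closure of `B` in `L'`, with 2-divisible class group. Then
  `Δ(B|ℝ[x]) = 𝔇⁻¹ = (s² + t²) · I²` for some `s, t ∈ L` and a fractional ideal `I` of `B`.

The proof follows the printed proof of Cor. 4.2 ("the ideal norm map `N_{B|A}` induces a
homomorphism `Cl B → Cl₊ A` … it suffices to show that `𝔭` is the norm of an ideal in `B` …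
`k(𝔭) = ℂ` … the residue degree is `1`, so `N(𝔮) = 𝔭`"), with Mathlib's relative ideal norm
`Ideal.relNorm` and `Ideal.relNorm_eq_pow_of_isMaximal`:

* `exists_eq_add_mul_j_of_integralClosure` — `B' = B[j]` (`2u = Tr`, `u² + v² = N` are
  integral) [folklore]; `norm_one_j`, `trace_one_j` — norm and trace of `u + vj`;
* `inertiaDeg_eq_one_of_sq_add_one_mem` — a prime `𝔮` of `B` with `i₀² ≡ −1 (mod 𝔮)` has all
  primes of `B'` above it of residue degree `1` (`j ≡ ± i₀`) [folklore];
* `exists_coeIdeal_eq_spanSingleton_mul_sq` — hence, if `Cl B'` is 2-divisible, such a `𝔮` is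
  `(s² + t²) · I²`: `x𝔓 = yE²` in `B'` (class group), take `N_{B'|B}`: `N(x) 𝔮 = N(y) N(E)²`,
  and norms from `B[j]` are sums of two squares [cite: Hanselka2017, Cor. 4.2 (proof)];
* products and inverses of sums of two squares are sums of two squares (Brahmagupta), and
  `𝔇 = ∏ 𝔮^{m_𝔮}` over non-real primes.

All statements are theorems; no definitions, no named facts; Theorem 4.1 enters only as the
hypothesis `hdiv`.

## References

* [Hanselka2017] C. Hanselka, J. Algebra 487 (2017) 340–356: Thm. 4.1, Cor. 4.2, §5.
* G. Frey, On the structure of the class group of a function field, Arch. Math. 33 (1979) 33–40.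
-/

noncomputable section

open Polynomial nonZeroDivisors Module

namespace Literature.AlgebraicGeometry.DeterminantalHypersurfaces

/-! ### Sums of two squares -/

/-- Brahmagupta–Fibonacci: products of sums of two squares are sums of two squares. [folklore] -/
theorem exists_sq_add_sq_eq_mul {F : Type*} [CommRing F] (s t u v : F) :
    ∃ a b : F, (s ^ 2 + t ^ 2) * (u ^ 2 + v ^ 2) = a ^ 2 + b ^ 2 :=
  ⟨s * u - t * v, s * v + t * u, by ring⟩

/-- The inverse of a non-zero sum of two squares in a field is a sum of two squares.
[folklore] -/
theorem exists_sq_add_sq_eq_inv {F : Type*} [Field F] (s t : F) :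
    ∃ a b : F, (s ^ 2 + t ^ 2)⁻¹ = a ^ 2 + b ^ 2 := by
  by_cases h : s ^ 2 + t ^ 2 = 0
  · exact ⟨0, 0, by rw [h]; ring⟩
  · exact ⟨s / (s ^ 2 + t ^ 2), t / (s ^ 2 + t ^ 2), by field_simp⟩

/-! ### Quadratic extensions `L' = L(j)`, `j² = −1` -/

section Quadratic

variable {L L' : Type*} [Field L] [Field L'] [Algebra L L']

/-- If `−1` is not a square in `L` and `j² = −1` in a quadratic extension `L'`, then `1, j` is an
`L`-basis of `L'`. [folklore] -/
theorem linearIndependent_one_j (hL : ∀ x : L, x * x ≠ -1) {j : L'} (hj : j * j = -1) :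
    LinearIndependent L ![(1 : L'), j] := by
  rw [LinearIndependent.pair_iff]
  intro s t hst
  by_cases ht : t = 0
  · subst ht
    simp only [zero_smul, add_zero, smul_eq_zero, one_ne_zero, or_false] at hst
    exact ⟨hst, rfl⟩
  · exfalso
    have hj' : j = algebraMap L L' (-s / t) := by
      rw [Algebra.smul_def, Algebra.smul_def, mul_one] at hst
      rw [map_div₀, map_neg, eq_div_iff ((_root_.map_ne_zero _).mpr ht)]
      linear_combination hst
    apply hL (-s / t)
    apply (algebraMap L L').injective
    rw [map_mul, ← hj', map_neg, map_one, hj]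

/-- The basis `1, j` of the quadratic extension `L' = L(j)`. [folklore] -/
theorem exists_basis_one_j (hL : ∀ x : L, x * x ≠ -1) {j : L'} (hj : j * j = -1)
    (h2 : Module.finrank L L' = 2) :
    ∃ b : Module.Basis (Fin 2) L L', b 0 = 1 ∧ b 1 = j := by
  haveI : FiniteDimensional L L' := Module.finite_of_finrank_pos (by rw [h2]; norm_num)
  have hcard : Fintype.card (Fin 2) = Module.finrank L L' := by rw [Fintype.card_fin, h2]
  have hli := linearIndependent_one_j hL hj
  refine ⟨basisOfLinearIndependentOfCardEqFinrank hli hcard, ?_, ?_⟩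
  · rw [coe_basisOfLinearIndependentOfCardEqFinrank]
    exact Matrix.cons_val_zero _ _
  · rw [coe_basisOfLinearIndependentOfCardEqFinrank]
    exact Matrix.cons_val_one _ _

/-- Multiplication table in the basis `1, j`: the matrix of `u + v j` is `[[u, -v], [v, u]]`.
[folklore] -/
theorem leftMulMatrix_one_j {j : L'} (hj : j * j = -1) (b : Module.Basis (Fin 2) L L')
    (hb0 : b 0 = 1) (hb1 : b 1 = j) (u v : L) :
    Algebra.leftMulMatrix b (algebraMap L L' u + algebraMap L L' v * j) =
      !![u, -v; v, u] := by
  have hrepr : ∀ x y : L, b.repr (algebraMap L L' x + algebraMap L L' y * j) =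
      Finsupp.single 0 x + Finsupp.single 1 y := by
    intro x y
    have : algebraMap L L' x + algebraMap L L' y * j = x • b 0 + y • b 1 := by
      rw [hb0, hb1, Algebra.smul_def, Algebra.smul_def, mul_one]
    rw [this, map_add, map_smul, map_smul, b.repr_self, b.repr_self, Finsupp.smul_single,
      Finsupp.smul_single, smul_eq_mul, smul_eq_mul, mul_one, mul_one]
  ext i k
  rw [Algebra.leftMulMatrix_eq_repr_mul]
  fin_cases k
  · -- column 0: `(u + v j) * 1`
    have : (algebraMap L L' u + algebraMap L L' v * j) * b 0 =
        algebraMap L L' u + algebraMap L L' v * j := by rw [hb0, mul_one]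
    simp only [Fin.zero_eta, Fin.isValue]
    rw [this, hrepr]
    fin_cases i <;> simp
  · -- column 1: `(u + v j) * j = -v + u j`
    have : (algebraMap L L' u + algebraMap L L' v * j) * b 1 =
        algebraMap L L' (-v) + algebraMap L L' u * j := by
      rw [hb1, add_mul, mul_assoc, hj, map_neg]; ring
    simp only [Fin.mk_one, Fin.isValue]
    rw [this, hrepr]
    fin_cases i <;> simp

/-- Norm in the basis `1, j`: `N(u + v j) = u² + v²`. [folklore] -/
theorem norm_one_j {j : L'} (hj : j * j = -1) (b : Module.Basis (Fin 2) L L')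
    (hb0 : b 0 = 1) (hb1 : b 1 = j) (u v : L) :
    Algebra.norm L (algebraMap L L' u + algebraMap L L' v * j) = u ^ 2 + v ^ 2 := by
  rw [Algebra.norm_eq_matrix_det b, leftMulMatrix_one_j hj b hb0 hb1, Matrix.det_fin_two_of]
  ring

/-- Trace in the basis `1, j`: `Tr(u + v j) = 2u`. [folklore] -/
theorem trace_one_j {j : L'} (hj : j * j = -1) (b : Module.Basis (Fin 2) L L')
    (hb0 : b 0 = 1) (hb1 : b 1 = j) (u v : L) :
    Algebra.trace L L' (algebraMap L L' u + algebraMap L L' v * j) = 2 * u := by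
  classical
  rw [Algebra.trace_eq_matrix_trace b, leftMulMatrix_one_j hj b hb0 hb1, Matrix.trace_fin_two_of]
  ring

/-- Every element of `L'` is `u + v j` (`u, v ∈ L`). [folklore] -/
theorem exists_eq_add_mul_j {j : L'} (b : Module.Basis (Fin 2) L L') (hb0 : b 0 = 1) (hb1 : b 1 = j)
    (e : L') : ∃ u v : L, e = algebraMap L L' u + algebraMap L L' v * j := by
  refine ⟨b.repr e 0, b.repr e 1, ?_⟩
  conv_lhs => rw [← b.sum_repr e]
  rw [Fin.sum_univ_two, hb0, hb1, Algebra.smul_def, Algebra.smul_def, mul_one]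

end Quadratic


/-! ### The integral closure in `L(j)` is `B[j]` -/

section Integral

variable {B L L' B' : Type*} [CommRing B] [IsIntegrallyClosed B] [Field L]
  [Field L'] [Algebra B L] [IsFractionRing B L] [Algebra L L'] [Algebra B L']
  [IsScalarTower B L L'] [FiniteDimensional L L']
  [CommRing B'] [Algebra B B'] [Algebra B' L'] [IsScalarTower B B' L'] [IsIntegralClosure B' B L']

/-- **`B' = B[j]`.** If `2` is a unit in the integrally closed domain `B` with fraction field
`L`, `−1` is not a square in `L`, and `L' = L(j)` with `j² = −1` is quadratic over `L`, then
every element of the integral closure `B'` of `B` in `L'` is `u + v j` with `u, v ∈ B`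
(`2u = Tr(e)` and `u² + v² = N(e)` are integral). [folklore] -/
theorem exists_eq_add_mul_j_of_integralClosure (htwo : IsUnit (2 : B))
    (hL : ∀ x : L, x * x ≠ -1) {j : L'} (hj : j * j = -1) (h2 : Module.finrank L L' = 2)
    (e : B') : ∃ u v : B, algebraMap B' L' e = algebraMap B L' u + algebraMap B L' v * j := by
  obtain ⟨b, hb0, hb1⟩ := exists_basis_one_j hL hj h2
  obtain ⟨u, v, huv⟩ := exists_eq_add_mul_j b hb0 hb1 (algebraMap B' L' e)
  have hint : IsIntegral B (algebraMap B' L' e) :=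
    (IsIntegralClosure.isIntegral B L' e).map (IsScalarTower.toAlgHom B B' L')
  -- `2u = Tr(e)` is integral, hence `u` is
  have htr : IsIntegral B (Algebra.trace L L' (algebraMap B' L' e)) :=
    Algebra.isIntegral_trace hint
  rw [huv, trace_one_j hj b hb0 hb1] at htr
  have hu : IsIntegral B u := by
    obtain ⟨w, hw⟩ := htwo
    have hu2 : u = algebraMap B L ↑w⁻¹ * (2 * u) := by
      rw [← mul_assoc, ← map_ofNat (algebraMap B L) 2, ← hw, ← map_mul, Units.inv_mul, map_one,
        one_mul]
    rw [hu2]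
    exact isIntegral_algebraMap.mul htr
  obtain ⟨u', hu'⟩ := IsIntegrallyClosed.isIntegral_iff.mp hu
  -- `u² + v² = N(e)` is integral, hence `v²` and `v` are
  have hn : IsIntegral B (Algebra.norm L (algebraMap B' L' e)) := Algebra.isIntegral_norm L hint
  rw [huv, norm_one_j hj b hb0 hb1] at hn
  have hv2 : IsIntegral B (v ^ 2) := by
    have : v ^ 2 = (u ^ 2 + v ^ 2) - u ^ 2 := by ring
    rw [this]
    exact hn.sub (hu.pow 2)
  obtain ⟨v', hv'⟩ := IsIntegrallyClosed.isIntegral_iff.mp (IsIntegral.of_pow two_pos hv2)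
  refine ⟨u', v', ?_⟩
  rw [huv, ← hu', ← hv', ← IsScalarTower.algebraMap_apply, ← IsScalarTower.algebraMap_apply]

include B in
omit [IsIntegrallyClosed B] [IsFractionRing B L] [FiniteDimensional L L'] [Algebra B B']
  [IsScalarTower B B' L'] in
/-- An element `jB ∈ B'` mapping to `j`. [folklore] -/
theorem exists_algebraMap_eq_j [Nontrivial B] {j : L'} (hj : j * j = -1) :
    ∃ jB : B', algebraMap B' L' jB = j := by
  refine (IsIntegralClosure.isIntegral_iff (A := B') (R := B)).mp
    ⟨X ^ 2 + 1, (monic_X_pow 2).add_of_left ?_, ?_⟩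
  · rw [degree_one, degree_X_pow]
    norm_num
  · rw [eval₂_add, eval₂_X_pow, eval₂_one, sq, hj, neg_add_cancel]

end Integral

section Dedekind

variable {B L L' B' : Type*} [CommRing B] [IsDedekindDomain B] [Field L]
  [Field L'] [Algebra B L] [IsFractionRing B L] [Algebra L L'] [Algebra B L']
  [IsScalarTower B L L'] [FiniteDimensional L L']
  [CommRing B'] [Algebra B B'] [Algebra B' L'] [IsScalarTower B B' L'] [IsIntegralClosure B' B L']

/-- **Non-real primes have residue degree one in `B' = B[j]`.** With `B, L, L', B', j` as above
(`B` a Dedekind domain), let `𝔮` be a maximal ideal of `B` modulo which `−1` is a square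
(`i₀² + 1 ∈ 𝔮`). Then every prime `𝔓` of `B'` over `𝔮` has inertia degree `1`: in the field
`B'/𝔓`, `j ≡ ± i₀`, and `B' = B[j]`. [folklore] -/
theorem inertiaDeg_eq_one_of_sq_add_one_mem (htwo : IsUnit (2 : B))
    (hL : ∀ x : L, x * x ≠ -1) {j : L'} (hj : j * j = -1) (h2 : Module.finrank L L' = 2)
    {q : Ideal B} [q.IsMaximal] {i₀ : B} (hi₀ : i₀ * i₀ + 1 ∈ q) (P : Ideal B') [P.IsMaximal]
    [P.LiesOver q] : P.inertiaDeg B = 1 := by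
  letI := Ideal.Quotient.field q
  letI := Ideal.Quotient.field P
  rw [Ideal.inertiaDeg_eq_of_isMaximal q P]
  obtain ⟨jB, hjB⟩ := exists_algebraMap_eq_j (B := B) (B' := B') hj
  have hjB2 : jB * jB = -1 := by
    apply IsIntegralClosure.algebraMap_injective B' B L'
    rw [map_mul, hjB, hj, map_neg, map_one]
  set ι := algebraMap (B ⧸ q) (B' ⧸ P) with hι
  have hιmk : ∀ b : B, ι (Ideal.Quotient.mk q b) = Ideal.Quotient.mk P (algebraMap B B' b) :=
    fun b => rfl
  -- `j ≡ ± i₀ (mod 𝔓)`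
  have hprod : (Ideal.Quotient.mk P jB - ι (Ideal.Quotient.mk q i₀)) *
      (Ideal.Quotient.mk P jB + ι (Ideal.Quotient.mk q i₀)) = 0 := by
    rw [hιmk, ← map_sub, ← map_add, ← map_mul, Ideal.Quotient.eq_zero_iff_mem]
    have hcalc : (jB - algebraMap B B' i₀) * (jB + algebraMap B B' i₀) =
        -(algebraMap B B' (i₀ * i₀ + 1)) := by
      rw [map_add, map_mul, map_one]
      linear_combination hjB2
    rw [hcalc, Ideal.neg_mem_iff]
    exact (Ideal.mem_of_liesOver P q _).mp hi₀
  have hsign : Ideal.Quotient.mk P jB = ι (Ideal.Quotient.mk q i₀) ∨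
      Ideal.Quotient.mk P jB = -ι (Ideal.Quotient.mk q i₀) := by
    rcases mul_eq_zero.mp hprod with h | h
    · exact Or.inl (sub_eq_zero.mp h)
    · exact Or.inr (eq_neg_of_add_eq_zero_left h)
  -- surjectivity of `B/𝔮 → B'/𝔓`
  have hsurj : Function.Surjective ι := by
    intro x
    obtain ⟨e, rfl⟩ := Ideal.Quotient.mk_surjective x
    obtain ⟨u, v, huv⟩ := exists_eq_add_mul_j_of_integralClosure htwo hL hj h2 e
    have he : e = algebraMap B B' u + algebraMap B B' v * jB := by
      apply IsIntegralClosure.algebraMap_injective B' B L'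
      rw [huv, map_add, map_mul, hjB, ← IsScalarTower.algebraMap_apply,
        ← IsScalarTower.algebraMap_apply]
    rcases hsign with hs | hs
    · refine ⟨Ideal.Quotient.mk q (u + v * i₀), ?_⟩
      rw [he]
      simp only [map_add, map_mul, hs, hιmk]
    · refine ⟨Ideal.Quotient.mk q (u - v * i₀), ?_⟩
      rw [he]
      simp only [map_add, map_mul, hs, hιmk, mul_neg, sub_eq_add_neg, map_neg]
  have hbij : Function.Bijective ι := ⟨ι.injective, hsurj⟩
  rw [← (AlgEquiv.ofBijective (Algebra.ofId (B ⧸ q) (B' ⧸ P)) hbij).toLinearEquiv.finrank_eq,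
    Module.finrank_self]

variable [IsDedekindDomain B'] [Module.Finite B B'] [Module.IsTorsionFree B B']

/-- The norm of an element of `B' = B[j]` is a sum of two squares `u² + v²`, `u, v ∈ L`.
[folklore] -/
theorem exists_intNorm_eq_sq_add_sq (hL : ∀ x : L, x * x ≠ -1)
    {j : L'} (hj : j * j = -1) (h2 : Module.finrank L L' = 2) (e : B') :
    ∃ u v : L, algebraMap B L (Algebra.intNorm B B' e) = u ^ 2 + v ^ 2 := by
  obtain ⟨b, hb0, hb1⟩ := exists_basis_one_j hL hj h2
  obtain ⟨u, v, huv⟩ := exists_eq_add_mul_j b hb0 hb1 (algebraMap B' L' e)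
  refine ⟨u, v, ?_⟩
  rw [Algebra.algebraMap_intNorm (K := L) (L := L'), huv, norm_one_j hj b hb0 hb1]

/-- **A non-real prime is a sum of two squares times a square** (the heart of Hanselka 2017,
Cor. 4.2): with `B, L, L' = L(j), B' = B[j]` as above and assuming the class group of `B'` is
2-divisible, every maximal ideal `𝔮 ≠ 0` of `B` modulo which `−1` is a square is, as a
fractional ideal, `(s² + t²) · I²` with `s, t ∈ L`. Proof: take `𝔓 | 𝔮` in `B'` (residue degree
`1`, so `N(𝔓) = 𝔮`); 2-divisibility gives `x 𝔓 = y E²` with `x, y ∈ B'`; take relative norms,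
`N(x), N(y)` being sums of two squares. [cite: Hanselka2017, Cor. 4.2 (proof)] -/
theorem exists_coeIdeal_eq_spanSingleton_mul_sq [PerfectField (FractionRing B)]
    (htwo : IsUnit (2 : B)) (hL : ∀ x : L, x * x ≠ -1) {j : L'}
    (hj : j * j = -1) (h2 : Module.finrank L L' = 2)
    (hdiv : ∀ x : ClassGroup B', ∃ y, x = y ^ 2) {q : Ideal B} [q.IsMaximal] (hq0 : q ≠ ⊥)
    {i₀ : B} (hi₀ : i₀ * i₀ + 1 ∈ q) :
    ∃ (s t : L) (I : FractionalIdeal B⁰ L), s ^ 2 + t ^ 2 ≠ 0 ∧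
      ((q : FractionalIdeal B⁰ L)) = FractionalIdeal.spanSingleton B⁰ (s ^ 2 + t ^ 2) * I ^ 2 := by
  -- a prime of `B'` over `𝔮`, of residue degree one
  obtain ⟨P, hPmax, hPover⟩ := Ideal.exists_maximal_ideal_liesOver_of_isIntegral (S := B') q
  have hf : P.inertiaDeg B = 1 := inertiaDeg_eq_one_of_sq_add_one_mem htwo hL hj h2 hi₀ P
  have hNP : Ideal.relNorm B P = q := by
    rw [Ideal.relNorm_eq_pow_of_isMaximal P q, hf, pow_one]
  have hP0 : P ≠ ⊥ := Ideal.ne_bot_of_liesOver_of_ne_bot hq0 P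
  -- 2-divisibility of the class group: `(x) 𝔓 = (y) E²`
  obtain ⟨c, hc⟩ := hdiv (ClassGroup.mk0 ⟨P, mem_nonZeroDivisors_iff_ne_zero.mpr hP0⟩)
  obtain ⟨E, rfl⟩ := ClassGroup.mk0_surjective c
  rw [← map_pow, ClassGroup.mk0_eq_mk0_iff] at hc
  obtain ⟨x, y, hx, hy, hxy⟩ := hc
  rw [SubmonoidClass.coe_pow] at hxy
  -- take relative norms
  have hN := congrArg (Ideal.relNorm B) hxy
  rw [map_mul, map_mul, map_pow, Ideal.relNorm_singleton, Ideal.relNorm_singleton, hNP] at hN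
  -- pass to fractional ideals of `B`
  have hfrac := congrArg (fun J : Ideal B => (J : FractionalIdeal B⁰ L)) hN
  simp only [FractionalIdeal.coeIdeal_mul, FractionalIdeal.coeIdeal_span_singleton,
    FractionalIdeal.coeIdeal_pow] at hfrac
  -- the norms are non-zero sums of two squares
  have hNx0 : algebraMap B L (Algebra.intNorm B B' x) ≠ 0 := by
    rw [Algebra.algebraMap_intNorm (K := L) (L := L'), Ne, Algebra.norm_eq_zero_iff]
    exact (map_ne_zero_iff _ (IsIntegralClosure.algebraMap_injective B' B L')).mpr hx
  have hNy0 : algebraMap B L (Algebra.intNorm B B' y) ≠ 0 := by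
    rw [Algebra.algebraMap_intNorm (K := L) (L := L'), Ne, Algebra.norm_eq_zero_iff]
    exact (map_ne_zero_iff _ (IsIntegralClosure.algebraMap_injective B' B L')).mpr hy
  obtain ⟨ux, vx, hNx⟩ := exists_intNorm_eq_sq_add_sq (B := B) (B' := B') hL hj h2 x
  obtain ⟨uy, vy, hNy⟩ := exists_intNorm_eq_sq_add_sq (B := B) (B' := B') hL hj h2 y
  obtain ⟨a, b, hab⟩ := exists_sq_add_sq_eq_inv ux vx
  obtain ⟨s, t, hst⟩ := exists_sq_add_sq_eq_mul uy vy a b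
  refine ⟨s, t, (Ideal.relNorm B (E : Ideal B') : FractionalIdeal B⁰ L), ?_, ?_⟩
  · rw [← hst, ← hab, ← hNx, ← hNy]
    exact mul_ne_zero hNy0 (inv_ne_zero hNx0)
  · rw [← hst, ← hab, ← hNx, ← hNy]
    set nx := algebraMap B L (Algebra.intNorm B B' x)
    set ny := algebraMap B L (Algebra.intNorm B B' y)
    calc (q : FractionalIdeal B⁰ L)
        = FractionalIdeal.spanSingleton B⁰ nx⁻¹ * (FractionalIdeal.spanSingleton B⁰ nx * q) := by
          rw [← mul_assoc, FractionalIdeal.spanSingleton_mul_spanSingleton, inv_mul_cancel₀ hNx0,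
            FractionalIdeal.spanSingleton_one, one_mul]
      _ = FractionalIdeal.spanSingleton B⁰ nx⁻¹ * (FractionalIdeal.spanSingleton B⁰ ny *
            (Ideal.relNorm B (E : Ideal B') : FractionalIdeal B⁰ L) ^ 2) := by rw [hfrac]
      _ = FractionalIdeal.spanSingleton B⁰ (ny * nx⁻¹) *
            (Ideal.relNorm B (E : Ideal B') : FractionalIdeal B⁰ L) ^ 2 := by
          rw [← mul_assoc, FractionalIdeal.spanSingleton_mul_spanSingleton, mul_comm nx⁻¹]

end Dedekind

/-! ### The codifferent of `B | ℝ[x]` is a sum of two squares times a square -/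

section Codifferent

variable {K L B : Type*} [Field K] [Field L] [Algebra ℝ[X] K] [IsFractionRing ℝ[X] K]
  [Algebra K L] [Algebra ℝ[X] L] [IsScalarTower ℝ[X] K L] [FiniteDimensional K L]
  [Algebra.IsSeparable K L]
  [CommRing B] [IsDedekindDomain B] [Algebra ℝ[X] B] [Algebra B L] [IsScalarTower ℝ[X] B L]
  [IsIntegralClosure B ℝ[X] L] [IsFractionRing B L] [Module.Finite ℝ[X] B]
  [Module.IsTorsionFree ℝ[X] B]
  {L' B' : Type*} [Field L'] [Algebra L L'] [Algebra B L'] [IsScalarTower B L L']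
  [FiniteDimensional L L']
  [CommRing B'] [IsDedekindDomain B'] [Algebra B B'] [Algebra B' L'] [IsScalarTower B B' L']
  [IsIntegralClosure B' B L'] [Module.Finite B B'] [Module.IsTorsionFree B B']

omit [FiniteDimensional K L] [IsIntegralClosure B ℝ[X] L] in
include K in
/-- **Hanselka 2017, Cor. 4.2 as used in §5, modulo Thm. 4.1.** Let `B` be the integral closure
of `ℝ[x]` in a finite extension `L` of `K = ℝ(x)` such that every prime of `B` dividing the
different `𝔇_{B|ℝ[x]}` is non-real (`−1` a square in its residue ring) and `−1` is not a square
in `L`; let `L' = L(j)`, `j² = −1`, be quadratic over `L` with integral closure `B'` of `B`, and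
assume (Hanselka's Thm. 4.1 for `B' = B ⊗ ℂ`) that the class group of `B'` is 2-divisible. Then
the codifferent `Δ(B|ℝ[x]) = 𝔇⁻¹` is `(s² + t²) · I²` for some `s, t ∈ L` and a fractional
ideal `I` of `B`. [cite: Hanselka2017, Cor. 4.2 and §5 ("the class of Δ in the narrow class group
Cl₊ B is a square")] -/
theorem exists_inv_differentIdeal_eq_spanSingleton_mul_sq (hL : ∀ x : L, x * x ≠ -1)
    {j : L'} (hj : j * j = -1) (h2 : Module.finrank L L' = 2)
    (hdiv : ∀ x : ClassGroup B', ∃ y, x = y ^ 2)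
    (hNR : ∀ q : Ideal B, q.IsPrime → q ≠ ⊥ → q ∣ differentIdeal ℝ[X] B →
      ∃ i : B ⧸ q, i * i = -1) :
    ∃ (s t : L) (I : FractionalIdeal B⁰ L), s ^ 2 + t ^ 2 ≠ 0 ∧
      FractionalIdeal.spanSingleton B⁰ (s ^ 2 + t ^ 2) * I ^ 2 =
        ((differentIdeal ℝ[X] B : Ideal B) : FractionalIdeal B⁰ L)⁻¹ := by
  classical
  -- instances: separability of the fraction rings, characteristic zero
  letI := FractionRing.liftAlgebra ℝ[X] (FractionRing B)
  haveI := FractionRing.isScalarTower_liftAlgebra ℝ[X] (FractionRing B)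
  haveI := Literature.NumberTheory.NumberFields.isSeparable_fractionRing_of_isSeparable ℝ[X] K L B
  haveI : CharZero B :=
    charZero_of_injective_algebraMap (FaithfulSMul.algebraMap_injective ℝ[X] B)
  haveI : CharZero (FractionRing B) :=
    charZero_of_injective_algebraMap (IsFractionRing.injective B (FractionRing B))
  haveI : PerfectField (FractionRing B) := PerfectField.ofCharZero
  have htwo : IsUnit (2 : B) := by
    have h : IsUnit (C (2 : ℝ) : ℝ[X]) := isUnit_C.mpr (by norm_num)
    have := h.map (algebraMap ℝ[X] B)
    rwa [show (C (2 : ℝ) : ℝ[X]) = 2 from rfl, map_ofNat] at this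
  set D := differentIdeal ℝ[X] B with hD
  have hD0 : D ≠ ⊥ := differentIdeal_ne_bot
  -- every prime factor of `𝔇` is `(s² + t²) I²`
  have hgood : ∀ q ∈ UniqueFactorizationMonoid.normalizedFactors D,
      ∃ (s t : L) (I : FractionalIdeal B⁰ L), s ^ 2 + t ^ 2 ≠ 0 ∧
        ((q : FractionalIdeal B⁰ L)) =
          FractionalIdeal.spanSingleton B⁰ (s ^ 2 + t ^ 2) * I ^ 2 := by
    intro q hq
    have hqprime : Prime q := UniqueFactorizationMonoid.prime_of_normalized_factor q hq
    haveI : q.IsPrime := Ideal.isPrime_of_prime hqprime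
    have hq0 : q ≠ ⊥ := hqprime.ne_zero
    haveI : q.IsMaximal := Ideal.IsPrime.isMaximal inferInstance hq0
    obtain ⟨i, hi⟩ :=
      hNR q inferInstance hq0 (UniqueFactorizationMonoid.dvd_of_mem_normalizedFactors hq)
    obtain ⟨i₀, rfl⟩ := Ideal.Quotient.mk_surjective i
    have hi₀ : i₀ * i₀ + 1 ∈ q := by
      rw [← Ideal.Quotient.eq_zero_iff_mem, map_add, map_mul, map_one, hi, neg_add_cancel]
    exact exists_coeIdeal_eq_spanSingleton_mul_sq htwo hL hj h2 hdiv hq0 hi₀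
  -- multiply up along the factorisation of `𝔇`
  have hmul : ∀ M : Multiset (Ideal B), (∀ q ∈ M, ∃ (s t : L) (I : FractionalIdeal B⁰ L),
      s ^ 2 + t ^ 2 ≠ 0 ∧
        ((q : FractionalIdeal B⁰ L)) = FractionalIdeal.spanSingleton B⁰ (s ^ 2 + t ^ 2) * I ^ 2) →
      ∃ (s t : L) (I : FractionalIdeal B⁰ L), s ^ 2 + t ^ 2 ≠ 0 ∧
        ((M.prod : Ideal B) : FractionalIdeal B⁰ L) =
          FractionalIdeal.spanSingleton B⁰ (s ^ 2 + t ^ 2) * I ^ 2 := by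
    intro M
    induction M using Multiset.induction_on with
    | empty =>
      intro _
      refine ⟨1, 0, 1, by norm_num, ?_⟩
      rw [Multiset.prod_zero, Ideal.one_eq_top, FractionalIdeal.coeIdeal_top]
      norm_num
    | cons q M ih =>
      intro h
      obtain ⟨s₁, t₁, I₁, h₁, e₁⟩ := h q (Multiset.mem_cons_self q M)
      obtain ⟨s₂, t₂, I₂, h₂, e₂⟩ := ih fun q' hq' => h q' (Multiset.mem_cons_of_mem hq')
      obtain ⟨a, b, hab⟩ := exists_sq_add_sq_eq_mul s₁ t₁ s₂ t₂
      refine ⟨a, b, I₁ * I₂, ?_, ?_⟩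
      · rw [← hab]; exact mul_ne_zero h₁ h₂
      · rw [Multiset.prod_cons, FractionalIdeal.coeIdeal_mul, e₁, e₂, ← hab,
          ← FractionalIdeal.spanSingleton_mul_spanSingleton]
        ring
  obtain ⟨s, t, J, hst, hJ⟩ := hmul _ hgood
  rw [Ideal.prod_normalizedFactors_eq_self hD0] at hJ
  -- invert
  obtain ⟨a, b, hab⟩ := exists_sq_add_sq_eq_inv s t
  refine ⟨a, b, J⁻¹, ?_, ?_⟩
  · rw [← hab]; exact inv_ne_zero hst
  · rw [hJ, mul_inv, ← inv_pow, ← hab, FractionalIdeal.spanSingleton_inv]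

omit [Module.Finite ℝ[X] B] in
include K in
/-- The same conclusion for the codifferent `Δ(B|ℝ[x]) = dual(1)` (Mathlib's
`FractionalIdeal.dual`). [cite: Hanselka2017, Cor. 4.2 and §5] -/
theorem exists_dual_eq_spanSingleton_mul_sq (hL : ∀ x : L, x * x ≠ -1)
    {j : L'} (hj : j * j = -1) (h2 : Module.finrank L L' = 2)
    (hdiv : ∀ x : ClassGroup B', ∃ y, x = y ^ 2)
    (hNR : ∀ q : Ideal B, q.IsPrime → q ≠ ⊥ → q ∣ differentIdeal ℝ[X] B →
      ∃ i : B ⧸ q, i * i = -1) :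
    ∃ (s t : L) (I : FractionalIdeal B⁰ L), s ^ 2 + t ^ 2 ≠ 0 ∧
      FractionalIdeal.spanSingleton B⁰ (s ^ 2 + t ^ 2) * I ^ 2 = FractionalIdeal.dual ℝ[X] K 1 := by
  haveI : Module.Finite ℝ[X] B := IsIntegralClosure.finite ℝ[X] K L B
  obtain ⟨s, t, I, hst, h⟩ :=
    exists_inv_differentIdeal_eq_spanSingleton_mul_sq (K := K) hL hj h2 hdiv hNR
  refine ⟨s, t, I, hst, ?_⟩
  rw [h, coeIdeal_differentIdeal ℝ[X] K L B, inv_inv]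

end Codifferent

end Literature.AlgebraicGeometry.DeterminantalHypersurfaces
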